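import Summits.KontsevichZagierPeriods.KontsevichZagierPeriods.Theses.IsogenyCertificates
import Literature.NumberTheory.Transcendental.KZSubcalculusInvariants
import Literature.NumberTheory.Transcendental.SemialgebraicMapsProofs

/-!
# Disproof of `RealPeriodSectorComplete` (stmt-KontsevichZagierPeriods-5381) — standing adversary, gen 1

**Verdict so far: the crux RESISTS.** It is an instance family of the summit (Kontsevich–Zagier,
Conjecture 1) on the sector of real periods `∫_{P>0} dx/√P` of elliptic curves `y² = P(x) =
x³ + Ax + B` over `ℤ`; its truth fails only with the summit. This work file records, as Lean
theorems, what any proof must use, which nearby statements are false, and why no cheap kill exists.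

Findings (section numbers refer to the file):

1. READING (§1). The crux: for nonsingular integral `(A,B)`, `(A′,B′)`, rationals `a, b > 0` and
   `r = [{P>0}, a/√P]`, `r′ = [{P′>0}, b/√P′]` (dimension 1; the integrand is pinned only ON the
   domain), `r.value = r′.value → KZ.Equivalent r r′`. No junk: on `{P>0}` `Real.sqrt` is the true
   root; `{P>0}` contains the ray `x > |A|+|B|+1` (`cubic_pos_of_lt`), so the value has the sign of
   the coefficient (`value_pos`, `value_eq_zero`, `value_neg_of_neg`). NOT VACUOUS: the hypotheses
   are inhabited — `fermatRep a = [{x³−1>0}, a/√(x³−1)]` is an honest `IntegralRep 1` (all three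
   structure fields proved; the semialgebraicity lemmas `isSemialgebraic_dom`,
   `isSemialgebraicFunOn_integrand` hold for ALL `(A, B, a)`), value `a·ϖ₃`,
   `ϖ₃ = ∫₁^∞ dt/√(t³−1) > 0` (`value_fermatRep`, `fermatPeriod_pos`). NOT TRIVIAL: see 4–5.
2. NO EVALUATION KILL: `KZ.relations ≤ ker eval` (tree, `relations_le_ker_eval_holds`) and value
   equality is a hypothesis. A kill needs an additive invariant of `KZ.relations` finer than `eval`
   separating two equal-valued representations — i.e. a disproof of Conjecture 1 as formalised. The
   tree's two sub-calculus invariants (`KZ.coeffSum`, `KZ.restrictedEval`) are killed by / not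
   preserved under the full move set, so they only refute STRENGTHENINGS (item 5).
3. LOAD-BEARING HYPOTHESES (§2). `r.value = r′.value`: YES —
   `realPeriodSectorComplete_false_without_valueEq` (witness `fermatRep 1` vs `fermatRep 2`).
   `0 < a`, `0 < b`: NO — `realPeriodSectorComplete_iff_withoutPos`: the crux is EQUIVALENT to its
   version over all rational `a, b` (value equality forces `sign a = sign b`; zero coefficients give
   relations; negative ones are the positive case for `r.neg`). `4A³+27B² ≠ 0`: NOT load-bearing
   for truth: a singular integral `P` is `(x−e)²(x+2e)` with `e ∈ ℤ`; `e ≥ 0` ⇒ `a/√P` is not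
   integrable at the double root / cusp ⇒ no such `r` (vacuous; the cusp `A = B = 0` is formalised:
   `no_rep_cusp`, §5); `e < 0` ⇒ `{P>0} = (−2e, ∞)` and the value is `a·π/√(3|e|)` (`u = √(x+2e)`):
   singular–singular equal values ⇔ `e′ = e·(b/a)²` ⇔ one scaling move (true); singular–nonsingular
   `a·π/√(3|e|) = b·Ω⁺(E′)` is impossible (`Ω/π ∉ ℚ̄`, Schneider 1937) ⇒ vacuous. So `Δ ≠ 0` only
   discards genus-0 and vacuous instances.
4. TIGHTNESS / STRUCTURE (§3, §4). The DIAGONAL `(A,B) = (A′,B′)` is a theorem in one move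
   (`realPeriodSectorComplete_diag`: value equality forces `a = b`). ℚ-ISOMORPHIC MODELS
   `(A′,B′) = (u⁴A, u⁶B)`, `b = u·a` are ONE rule-2) move (`of_fermatRep_sub_of_fermat64Rep_mem`:
   `y² = x³−1` vs `y² = x³−64`, `Φ(x) = 4x`, `|det Φ′| = 4`); the value of the second model is read
   off from SOUNDNESS (`value_fermat64Rep`). On the witnesses the KZ-classes are exactly the
   period-ratio lines: `[F₁, a] ~ [F₁, b] ↔ a = b`, `[F₁, a] ~ [F₆₄, b] ↔ b = 2a`
   (`equivalent_fermatRep_iff`, `equivalent_fermatRep_fermat64Rep_iff`) — the calculus sees the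
   period ratio and nothing else, exactly as the crux predicts.
5. REFUTED STRENGTHENINGS (§4). (a) `RealPeriodSectorCompleteWithoutValueEq` ("all pairs
   equivalent"): false. (b) `RealPeriodSectorCompleteDataRigid` ("equivalent ⇒ same `(A,B,a)`"):
   false (scaling witness). (c) `RealPeriodSectorCompleteByAdditivity` (conclusion in
   `closure (domainAddRel ∪ integrandAddRel)`): false — `restrictedEval` at the window `x ≤ 4`
   separates the scaling pair (`∫₁⁴ dx/√(x³−1) > 0` vs `0`): **a change of variables or a
   Newton–Leibniz move is NECESSARY in this sector, already for isomorphic models.**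
6. THE REDUCTION'S ESCAPE HATCH (planner's why-fail: a ℚ̄- but not ℚ-isogenous pair with rational
   real-period ratio would escape crux 3). Closed on paper in all cases (agreeing with refuters
   g40-0 / g41-9 / a560f082-g2): quadratic twist `d > 0`: ratio `∈ √d·ℚ`; `d < 0`: rational ratio ⇔
   `√|d|·Ω⁺/Ω⁻ ∈ ℚ` ⇒ `τ ∈ ℚ̄` ⇒ CM (Schneider) — so non-CM pairs never escape; CM field
   `ℚ(√−D)`: `Ω⁻/Ω⁺ ∈ ℚ·√D` (the lattice is a fractional ideal containing `1`), so rational ratio ⇔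
   `d ∼ −D`, and `E^{(−D)}` IS ℚ-isogenous (`ψ_d ∘ α`, `α ∈ End_K E` purely imaginary, is
   Galois-fixed); quartic / sextic twists (`j = 1728 / 0`): ratios `D^{-1/4}`, `|D|^{-1/4}/√2`,
   `k^{-1/6}`, `|k|^{-1/6}·√3·ρ` — rational iff `≅ E_{−4}` resp. `E_{−27}`, which are 2- resp.
   3-isogenous over ℚ. COMPUTATION (PARI, script `num/commensurable.gp` of the seat folder; periods
   by Gauss's AGM, exact to working precision: three real roots `e₁<e₂<e₃`:
   `Ω⁺ = 2π/agm(√(e₃−e₁), √(e₃−e₂))`; one real root `e₁`, `m² = P′(e₁)`: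
   `Ω⁺ = π/agm(√m, √((m + 3e₁/2)/2))`): all commensurable pairs (ratio of height `≤ 10⁴` to
   `10⁻⁴⁰` at 60 digits) among `|A|,|B| ≤ 30` and among the 13 CM `j`-invariants with quadratic
   twists `|d| ≤ 40` (all `(0,k)`, `(k,0)`, `|k| ≤ 80`), each tested for ℚ-isomorphy / ℚ-isogeny
   (`a_p` agree, `5 ≤ p < 400`): job j013811 (v2), plus j013822 (period-ratio tables of 18 isogeny
   classes incl. the 37-isogeny `j = −9317` and CM 43/67/163: explicit OFF-DIAGONAL inhabitants).
   RESULTS (j013811, AGM at 77 digits, calibration `Ω⁺(−1,0) = Γ(1/4)²/√(2π)` to `7·10⁻⁷⁷`):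
   BOX `|A|,|B| ≤ 30`: 3716 curves, 41 commensurable pairs = 2 ℚ-isomorphic + 39 ℚ-isogenous
   (ratios ∈ {1, 2, 1/2, 3, 1/3}), **0 ESCAPES**; CM family (13 `j`'s, 892 curves): 160
   commensurable pairs = 12 isomorphic + 148 isogenous (ratios 1, 1/2, 2, 3, 1/3, 9, 7, 1/7, 11,
   19, 33, 66, 4, 2/3 — the `D`-isogenies of the CM twists appear with ratio `D` or `1`),
   **0 ESCAPES**. So within these bounds every rational real-period ratio comes from a ℚ-isogeny,
   as the reduction predicts. Tables (j013822): §7 at the end of this file — e.g. the 37-isogeny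
   pair `(−308718795, −2273199393850) ~ (−8009035567995, 8724056049444300950)` has EQUAL
   real-sector periods (`a = b = 1`), as do the CM 43-, 67-, 163-isogeny pairs: the hardest explicit
   inhabitants of the crux's hypotheses. LESSON from the v1 smoke run (j007831,
   `|A|,|B| ≤ 4`, twists `≤ 5`): tanh-sinh quadrature after compactifying `(e₁,∞)` is only
   `~10⁻³⁰`-accurate when the integrand has complex singularities near the path (e.g. `(A,B) =
   (4,0)`: ratio `Ω⁺(−1,0)/Ω⁺(4,0) = 2 − 1.6·10⁻³⁰`), so at tolerance `10⁻⁴⁰` v1 MISSED the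
   lemniscate pair — hence the AGM; v1's calibration `Ω⁺(−1,0) = Γ(1/4)²/√(2π)` held to `4·10⁻⁶¹`,
   and the two commensurable CM pairs it did find (`j = 8000` family, ratios `1/2`, `1`) were
   ℚ-isogenous, 0 escapes.
7. WHY IT RESISTS — PROVED (§6): **`realPeriodSectorComplete_of_kontsevichZagierPeriods :
   KontsevichZagierPeriods → RealPeriodSectorComplete`.** Each `[{P>0}, a/√P]` is ONE
   Newton–Leibniz move from the RATIONAL dimension-2 representation `[band, 1]` (area under the
   graph; `band` semialgebraic by the tree's Tarski–Seidenberg hypograph lemma, finite volume by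
   `volume_regionBetween_eq_lintegral'`; `of_bandRep_sub_of_mem_newtonLeibnizRel`), Conjecture 1
   connects the two areas (equal values by soundness), and the moves compose. So the crux is
   exactly the restriction of Conjecture 1 to this sector: refuting it = refuting the summit as
   formalised. Off the diagonal every instance is a genuine period identity between different
   curves (an isogeny read on the real locus); the only refuter's handle would be an invariant of
   the full move group.
8. Targets: none handed over (no skeleton yet). Near-misses: none.
9. LANDED in the tree (importable; namespace
   `Summit.KontsevichZagierPeriods.IsogenyCertificates.RealPeriodSectorCompleteNegative`; all
   accepted): `Summits/…/Theorems/RealPeriodSectorComplete/Negative/Data.lean` (p72841: §1),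
   `LoadBearing.lean` (p73535: §2, §3, §5), `Strengthenings.lean` (p74197: §4),
   `SummitImplies.lean` (p73938: §6 — `of_bandRep_sub_of_mem_newtonLeibnizRel` and
   `realPeriodSectorComplete_of_kontsevichZagierPeriods`, reusable by the hypograph line).

All theorems below are sorry-free; axioms ⊆ {propext, Classical.choice, Quot.sound}.
-/

noncomputable section

set_option linter.dupNamespace false

open MeasureTheory Set Filter MvPolynomial
open Literature.ModelTheory.ExponentialFields (IsSemialgebraic isSemialgebraic_setOf_eval_pos
  isSemialgebraic_setOf_eval_eq_zero)
open Literature.NumberTheory.Transcendental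
open Literature.NumberTheory.Transcendental.KZ

namespace Summit.KontsevichZagierPeriods.KontsevichZagierPeriods.Cruxes.RealPeriodSectorComplete.Disproof

open Summit.KontsevichZagierPeriods.KontsevichZagierPeriods.Theses.IsogenyCertificates
  (RealPeriodSectorComplete)

/-! ## §1 The data of the crux: domain `{P > 0}`, integrand `a/√P`, and one explicit inhabitant -/

/-- The real-locus domain `{x | P(x) > 0}` of the crux, `P = x³ + A x + B`. -/
def dom (A B : ℤ) : Set (Fin 1 → ℝ) := {x | 0 < x 0 ^ 3 + (A : ℝ) * x 0 + (B : ℝ)}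

/-- The crux integrand `a / √P`. -/
def integrand (A B : ℤ) (a : ℚ) (x : Fin 1 → ℝ) : ℝ :=
  (a : ℝ) / Real.sqrt (x 0 ^ 3 + (A : ℝ) * x 0 + (B : ℝ))

/-- `P` as a polynomial over `ℚ`. -/
def cubicPoly (A B : ℤ) : MvPolynomial (Fin 1) ℚ := X 0 ^ 3 + C (A : ℚ) * X 0 + C (B : ℚ)

/-- Evaluation of `cubicPoly`. [folklore] -/
theorem aeval_cubicPoly (A B : ℤ) (x : Fin 1 → ℝ) :
    aeval x (cubicPoly A B) = x 0 ^ 3 + (A : ℝ) * x 0 + (B : ℝ) := by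
  simp [cubicPoly, map_add, map_mul, map_pow]

/-- `{P > 0}` is `ℚ`-semialgebraic. [folklore] -/
theorem isSemialgebraic_dom (A B : ℤ) : IsSemialgebraic ℚ (dom A B) := by
  convert isSemialgebraic_setOf_eval_pos (R := ℝ) (cubicPoly A B) using 1
  ext x
  simp [dom, aeval_cubicPoly]

/-- `a/√P` is a `ℚ`-semialgebraic function on `{P > 0}` (for every rational `a`, any sign):
`a/√P = a · √P · (1/P)` there. [folklore] -/
theorem isSemialgebraicFunOn_integrand (A B : ℤ) (a : ℚ) :
    IsSemialgebraicFunOn ℚ (dom A B) (integrand A B a) := by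
  have hs := isSemialgebraic_dom A B
  have hP : ∀ x ∈ dom A B, aeval x (cubicPoly A B) ≠ 0 := fun x hx => by
    rw [aeval_cubicPoly]; exact (ne_of_gt hx)
  have ha : IsAlgebraic ℚ ((a : ℚ) : ℝ) := by
    simpa using isAlgebraic_algebraMap (R := ℚ) (A := ℝ) a
  have h1 : IsSemialgebraicFunOn ℚ (dom A B) (fun _ => ((a : ℚ) : ℝ)) :=
    isSemialgebraicFunOn_const_of_isAlgebraic hs ha
  have h2 : IsSemialgebraicFunOn ℚ (dom A B) (fun x => Real.sqrt (aeval x (cubicPoly A B))) :=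
    IsSemialgebraicFunOn.sqrt_holds (isSemialgebraicFunOn_aeval hs (cubicPoly A B))
  have h3 : IsSemialgebraicFunOn ℚ (dom A B)
      (fun x => aeval x (1 : MvPolynomial (Fin 1) ℚ) / aeval x (cubicPoly A B)) :=
    isSemialgebraicFunOn_aeval_div_aeval hs 1 (cubicPoly A B) hP
  have h4 := IsSemialgebraicFunOn.mul_holds h1 (IsSemialgebraicFunOn.mul_holds h2 h3)
  refine h4.congr (fun x hx => ?_)
  have hx' : 0 < x 0 ^ 3 + (A : ℝ) * x 0 + (B : ℝ) := hx
  have hsq : 0 < Real.sqrt (x 0 ^ 3 + (A : ℝ) * x 0 + (B : ℝ)) := Real.sqrt_pos.2 hx'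
  simp only [Pi.mul_apply, integrand, aeval_cubicPoly, map_one]
  rw [one_div, ← div_eq_mul_inv, Real.sqrt_div_self, div_eq_mul_inv]

/-- For `t > |A| + |B| + 1` the cubic is positive: `{P > 0}` contains a ray. [folklore] -/
theorem cubic_pos_of_lt (A B : ℤ) {t : ℝ} (ht : |(A : ℝ)| + |(B : ℝ)| + 1 < t) :
    0 < t ^ 3 + (A : ℝ) * t + (B : ℝ) := by
  have hA0 : 0 ≤ |(A : ℝ)| := abs_nonneg _
  have hB0 : 0 ≤ |(B : ℝ)| := abs_nonneg _
  have ht1 : 1 < t := by linarith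
  have ht0 : 0 < t := by linarith
  have hA : -(|(A : ℝ)| * t) ≤ (A : ℝ) * t := by
    have := neg_abs_le (A : ℝ)
    nlinarith
  have hB : -|(B : ℝ)| ≤ (B : ℝ) := neg_abs_le _
  have h2 : t ≤ t ^ 2 := by nlinarith
  have h3 : |(B : ℝ)| + 1 < t ^ 2 - |(A : ℝ)| := by linarith
  have h4 : (|(B : ℝ)| + 1) * t < (t ^ 2 - |(A : ℝ)|) * t := by nlinarith
  nlinarith

/-! ### The explicit inhabitant: the Fermat cubic `y² = x³ − 1` (`(A, B) = (0, −1)`, `Δ`-condition `27 ≠ 0`) -/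

/-- `ϖ₃ := ∫₁^∞ dt/√(t³ − 1)` (`= B(1/2, 1/6)/3 = 2.4286506…`), the real-sector period of `y² = x³ − 1`. -/
def fermatPeriod : ℝ := ∫ t in Ioi (1 : ℝ), (Real.sqrt (t ^ 3 - 1))⁻¹

/-- `t³ − 1 > 0` for `t > 1`. [folklore] -/
theorem cube_sub_one_pos {t : ℝ} (ht : 1 < t) : 0 < t ^ 3 - 1 := by
  have h1 : 1 < t ^ 2 := by nlinarith
  nlinarith

/-- `t − 1 ≤ t³ − 1` for `t ≥ 1`. [folklore] -/
theorem sub_one_le_cube_sub_one {t : ℝ} (ht : 1 ≤ t) : t - 1 ≤ t ^ 3 - 1 := by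
  have h : 0 ≤ t * (t - 1) * (t + 1) :=
    mul_nonneg (mul_nonneg (by linarith) (by linarith)) (by linarith)
  nlinarith [h]

/-- `t³/2 ≤ t³ − 1` for `t ≥ 2`. [folklore] -/
theorem half_cube_le_cube_sub_one {t : ℝ} (ht : 2 ≤ t) : t ^ 3 / 2 ≤ t ^ 3 - 1 := by
  have h4 : 4 ≤ t ^ 2 := by nlinarith
  have h8 : 8 ≤ t ^ 3 := by nlinarith
  linarith

/-- `(t³ − 1)^{-1/2}` is integrable on `(1, ∞)`: `≤ (t − 1)^{-1/2}` on `(1, 2]`, `≤ √2 · t^{-3/2}` on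
`(2, ∞)` (same shape as the tree's `integrableOn_inv_sqrt_cube_sub_self_Ioi`). [folklore] -/
theorem integrableOn_inv_sqrt_cube_sub_one_Ioi :
    IntegrableOn (fun t : ℝ => (Real.sqrt (t ^ 3 - 1))⁻¹) (Ioi 1) := by
  have hmeas : ∀ s : Set ℝ, s ⊆ Ioi 1 → MeasurableSet s →
      AEStronglyMeasurable (fun t : ℝ => (Real.sqrt (t ^ 3 - 1))⁻¹) (volume.restrict s) := by
    intro s hs hsm
    refine ContinuousOn.aestronglyMeasurable ?_ hsm
    refine ContinuousOn.inv₀ (by fun_prop) ?_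
    intro x hx
    exact (Real.sqrt_pos.2 (cube_sub_one_pos (hs hx))).ne'
  rw [← Ioc_union_Ioi_eq_Ioi (show (1 : ℝ) ≤ 2 by norm_num)]
  refine IntegrableOn.union ?_ ?_
  · have hint : IntegrableOn (fun x : ℝ => (x - 1) ^ (-(1 / 2 : ℝ))) (Ioc 1 2) := by
      have h := (intervalIntegral.intervalIntegrable_rpow' (a := 0) (b := 1)
        (r := -(1 / 2 : ℝ)) (by norm_num)).comp_sub_right 1
      have h' := (intervalIntegrable_iff_integrableOn_Ioc_of_le
        (show (0 : ℝ) + 1 ≤ 1 + 1 by norm_num)).1 h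
      simpa [one_add_one_eq_two] using h'
    refine Integrable.mono' hint (hmeas _ Ioc_subset_Ioi_self measurableSet_Ioc) ?_
    refine (ae_restrict_iff' measurableSet_Ioc).2 (Eventually.of_forall fun x hx => ?_)
    have hx1 : 0 < x - 1 := by linarith [hx.1]
    have hle : x - 1 ≤ x ^ 3 - 1 := sub_one_le_cube_sub_one hx.1.le
    rw [norm_inv, Real.norm_of_nonneg (Real.sqrt_nonneg _), Real.rpow_neg hx1.le,
      ← Real.sqrt_eq_rpow]
    exact inv_anti₀ (Real.sqrt_pos.2 hx1) (Real.sqrt_le_sqrt hle)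
  · have hint : IntegrableOn (fun x : ℝ => Real.sqrt 2 * x ^ (-(3 / 2 : ℝ))) (Ioi 2) :=
      (integrableOn_Ioi_rpow_of_lt (by norm_num) (by norm_num)).const_mul _
    refine Integrable.mono' hint
      (hmeas _ (Ioi_subset_Ioi (by norm_num)) measurableSet_Ioi) ?_
    refine (ae_restrict_iff' measurableSet_Ioi).2 (Eventually.of_forall fun x hx => ?_)
    have hx2 : (2 : ℝ) < x := hx
    have hx0 : 0 < x := by linarith
    have hle : x ^ 3 / 2 ≤ x ^ 3 - 1 := half_cube_le_cube_sub_one hx2.le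
    have hpos : 0 < x ^ 3 / 2 := by positivity
    rw [norm_inv, Real.norm_of_nonneg (Real.sqrt_nonneg _)]
    calc (Real.sqrt (x ^ 3 - 1))⁻¹ ≤ (Real.sqrt (x ^ 3 / 2))⁻¹ :=
          inv_anti₀ (Real.sqrt_pos.2 hpos) (Real.sqrt_le_sqrt hle)
      _ = Real.sqrt 2 * x ^ (-(3 / 2 : ℝ)) := by
          have hsq : Real.sqrt (x ^ 3) = x ^ (3 / 2 : ℝ) := by
            rw [Real.sqrt_eq_rpow, ← Real.rpow_natCast, ← Real.rpow_mul hx0.le]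
            norm_num
          rw [Real.sqrt_div' _ zero_le_two, inv_div, Real.rpow_neg hx0.le, div_eq_mul_inv, hsq]

/-- `ϖ₃ > 0`. [folklore] -/
theorem fermatPeriod_pos : 0 < fermatPeriod := by
  rw [fermatPeriod, setIntegral_pos_iff_support_of_nonneg_ae
    (Eventually.of_forall fun x => inv_nonneg.2 (Real.sqrt_nonneg _))
    integrableOn_inv_sqrt_cube_sub_one_Ioi]
  have hsub : Ioi (1 : ℝ) ⊆
      Function.support (fun t : ℝ => (Real.sqrt (t ^ 3 - 1))⁻¹) ∩ Ioi 1 := by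
    intro x hx
    exact ⟨(inv_pos.2 (Real.sqrt_pos.2 (cube_sub_one_pos (mem_Ioi.1 hx)))).ne', hx⟩
  calc (0 : ENNReal) < volume (Ioi (1 : ℝ)) := by simp
    _ ≤ _ := measure_mono hsub

/-- `ℝ¹ ≃ ℝ` is evaluation at `0`. [folklore] -/
theorem funUnique_apply_eq (x : Fin 1 → ℝ) : MeasurableEquiv.funUnique (Fin 1) ℝ x = x 0 := rfl

/-- `{x³ − 1 > 0} = {x > 1}` in `ℝ¹`, as the preimage of `(1, ∞)` under `ℝ¹ ≃ ℝ`. [folklore] -/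
theorem dom_fermat_eq : dom 0 (-1) = (MeasurableEquiv.funUnique (Fin 1) ℝ) ⁻¹' Ioi 1 := by
  ext x
  simp only [dom, Int.cast_zero, zero_mul, add_zero, Int.cast_neg, Int.cast_one, mem_setOf_eq,
    mem_preimage, mem_Ioi]
  have hq : 0 < x 0 ^ 2 + x 0 + 1 := by nlinarith [sq_nonneg (x 0 + 1 / 2)]
  have hf : x 0 ^ 3 + -1 = (x 0 - 1) * (x 0 ^ 2 + x 0 + 1) := by ring
  change 0 < x 0 ^ 3 + -1 ↔ 1 < x default
  rw [Fin.default_eq_zero, hf]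
  constructor
  · intro h
    by_contra hle
    push Not at hle
    have : (x 0 - 1) * (x 0 ^ 2 + x 0 + 1) ≤ 0 :=
      mul_nonpos_of_nonpos_of_nonneg (by linarith) hq.le
    linarith
  · intro h
    exact mul_pos (by linarith) hq

/-- The Fermat integrand factors through `ℝ¹ ≃ ℝ`. [folklore] -/
theorem integrand_fermat_eq (a : ℚ) :
    integrand 0 (-1) a = (fun t : ℝ => (a : ℝ) * (Real.sqrt (t ^ 3 - 1))⁻¹) ∘
      (MeasurableEquiv.funUnique (Fin 1) ℝ) := by
  funext x
  simp only [integrand, Int.cast_zero, zero_mul, add_zero, Int.cast_neg, Int.cast_one,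
    Function.comp_apply]
  rw [div_eq_mul_inv, ← sub_eq_add_neg]
  rfl

/-- `a/√(x³ − 1)` is integrable on `{x³ − 1 > 0}`. [folklore] -/
theorem integrableOn_integrand_fermat (a : ℚ) :
    IntegrableOn (integrand 0 (-1) a) (dom 0 (-1)) := by
  rw [dom_fermat_eq, integrand_fermat_eq]
  exact ((volume_preserving_funUnique (Fin 1) ℝ).integrableOn_comp_preimage
    (MeasurableEquiv.measurableEmbedding _)).2
    (integrableOn_inv_sqrt_cube_sub_one_Ioi.const_mul (a : ℝ))

/-- **An explicit inhabitant of the crux's hypotheses**: `[{x³ − 1 > 0}, a/√(x³ − 1)]`, the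
real-sector period representation of the Fermat cubic `y² = x³ − 1`, for any rational `a`. -/
def fermatRep (a : ℚ) : IntegralRep 1 where
  domain := dom 0 (-1)
  integrand := integrand 0 (-1) a
  isSemialgebraic_domain := isSemialgebraic_dom 0 (-1)
  isSemialgebraicFunOn_integrand := isSemialgebraicFunOn_integrand 0 (-1) a
  integrableOn := integrableOn_integrand_fermat a

/-- The domain of `fermatRep a`. [folklore] -/
@[simp] theorem fermatRep_domain (a : ℚ) : (fermatRep a).domain = dom 0 (-1) := rfl

/-- The integrand of `fermatRep a`. [folklore] -/
@[simp] theorem fermatRep_integrand (a : ℚ) : (fermatRep a).integrand = integrand 0 (-1) a := rfl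

/-- `value [{x³−1>0}, a/√(x³−1)] = a · ϖ₃`. [folklore] -/
theorem value_fermatRep (a : ℚ) : (fermatRep a).value = (a : ℝ) * fermatPeriod := by
  have h := (volume_preserving_funUnique (Fin 1) ℝ).setIntegral_preimage_emb
    (MeasurableEquiv.measurableEmbedding _) (fun t : ℝ => (a : ℝ) * (Real.sqrt (t ^ 3 - 1))⁻¹)
    (Ioi 1)
  show ∫ x in (fermatRep a).domain, (fermatRep a).integrand x = _
  rw [fermatRep_domain, fermatRep_integrand, dom_fermat_eq, integrand_fermat_eq]
  simp only [Function.comp_apply] at h ⊢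
  refine h.trans ?_
  rw [fermatPeriod, ← integral_const_mul]

/-- The hypotheses of the crux at `(A, B, a) = (0, −1, a)` hold for `fermatRep a` (by `rfl`). -/
theorem fermatRep_hyps (a : ℚ) :
    (fermatRep a).domain = {x | 0 < x 0 ^ 3 + ((0 : ℤ) : ℝ) * x 0 + ((-1 : ℤ) : ℝ)} ∧
    EqOn (fermatRep a).integrand
      (fun x => (a : ℝ) / Real.sqrt (x 0 ^ 3 + ((0 : ℤ) : ℝ) * x 0 + ((-1 : ℤ) : ℝ)))
      (fermatRep a).domain :=
  ⟨rfl, fun _ _ => rfl⟩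


/-! ## §2 Load-bearing analysis of the hypotheses -/

/-! ### (2a) `r.value = r'.value` IS load-bearing -/

/-- The crux with the value-equality hypothesis DROPPED ("all real-sector representations are
KZ-equivalent"). -/
def RealPeriodSectorCompleteWithoutValueEq : Prop :=
  ∀ (A B A' B' : ℤ), 4 * A ^ 3 + 27 * B ^ 2 ≠ 0 → 4 * A' ^ 3 + 27 * B' ^ 2 ≠ 0 → ∀ (a b : ℚ),
    0 < a → 0 < b → ∀ (r r' : IntegralRep 1),
    r.domain = {x | 0 < x 0 ^ 3 + (A : ℝ) * x 0 + (B : ℝ)} →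
    EqOn r.integrand (fun x => (a : ℝ) / Real.sqrt (x 0 ^ 3 + (A : ℝ) * x 0 + (B : ℝ))) r.domain →
    r'.domain = {x | 0 < x 0 ^ 3 + (A' : ℝ) * x 0 + (B' : ℝ)} →
    EqOn r'.integrand (fun x => (b : ℝ) / Real.sqrt (x 0 ^ 3 + (A' : ℝ) * x 0 + (B' : ℝ)))
      r'.domain →
    Equivalent r r'

/-- **Any proof must use `r.value = r'.value`**: without it the statement is false — witness the
Fermat cubic against itself with coefficients `a = 1`, `b = 2` (values `ϖ₃ ≠ 2ϖ₃`, and the calculus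
is sound, `KZ.Equivalent.value_eq_holds`). [folklore] -/
theorem realPeriodSectorComplete_false_without_valueEq : ¬ RealPeriodSectorCompleteWithoutValueEq := by
  intro h
  have hE := h 0 (-1) 0 (-1) (by norm_num) (by norm_num) 1 2 one_pos two_pos (fermatRep 1)
    (fermatRep 2) (fermatRep_hyps 1).1 (fermatRep_hyps 1).2 (fermatRep_hyps 2).1 (fermatRep_hyps 2).2
  have hv : (fermatRep 1).value = (fermatRep 2).value := Equivalent.value_eq_holds hE
  rw [value_fermatRep, value_fermatRep] at hv
  have := fermatPeriod_pos
  push_cast at hv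
  linarith

/-! ### (2b) `0 < a`, `0 < b` are NOT load-bearing (the sign of the value is the sign of the coefficient) -/

/-- Positive coefficient ⇒ positive value: `{P > 0}` contains the ray `x > |A| + |B| + 1`, of
positive measure, on which `a/√P > 0`; integrability is part of the representation. [folklore] -/
theorem value_pos {A B : ℤ} {a : ℚ} (ha : 0 < a) {r : IntegralRep 1} (hd : r.domain = dom A B)
    (hi : EqOn r.integrand (integrand A B a) r.domain) : 0 < r.value := by
  have hmeas : MeasurableSet r.domain := IntegralRep.measurableSet_domain_holds r
  unfold IntegralRep.value
  rw [setIntegral_pos_iff_support_of_nonneg_ae ?_ r.integrableOn]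
  · set M : ℝ := |(A : ℝ)| + |(B : ℝ)| + 1 with hM
    have hopen : IsOpen {x : Fin 1 → ℝ | M < x 0} := isOpen_lt continuous_const (continuous_apply 0)
    have hne : ({x : Fin 1 → ℝ | M < x 0}).Nonempty := ⟨fun _ => M + 1, by simp⟩
    have hpos : 0 < volume {x : Fin 1 → ℝ | M < x 0} := hopen.measure_pos volume hne
    refine hpos.trans_le (measure_mono fun x hx => ?_)
    have hP : 0 < x 0 ^ 3 + (A : ℝ) * x 0 + (B : ℝ) := cubic_pos_of_lt A B hx
    have hxd : x ∈ r.domain := by rw [hd]; exact hP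
    refine ⟨?_, hxd⟩
    rw [Function.mem_support, hi hxd]
    exact (div_pos (by exact_mod_cast ha) (Real.sqrt_pos.2 hP)).ne'
  · filter_upwards [ae_restrict_mem hmeas] with x hx
    rw [hi hx]
    exact div_nonneg (by exact_mod_cast ha.le) (Real.sqrt_nonneg _)

/-- Zero coefficient ⇒ zero value. [folklore] -/
theorem value_eq_zero {A B : ℤ} {r : IntegralRep 1}
    (hi : EqOn r.integrand (integrand A B 0) r.domain) : r.value = 0 := by
  unfold IntegralRep.value
  rw [setIntegral_congr_fun (IntegralRep.measurableSet_domain_holds r) hi]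
  simp [integrand]

/-- Negative coefficient ⇒ negative value. [folklore] -/
theorem value_neg_of_neg {A B : ℤ} {a : ℚ} (ha : a < 0) {r : IntegralRep 1} (hd : r.domain = dom A B)
    (hi : EqOn r.integrand (integrand A B a) r.domain) : r.value < 0 := by
  have h := value_pos (A := A) (B := B) (a := -a) (by linarith) (r := r.neg) hd (fun x hx => by
    simp only [IntegralRep.integrand_neg, Pi.neg_apply, integrand]
    rw [hi hx, integrand]
    push_cast
    ring)
  rw [IntegralRep.value_neg] at h
  linarith

/-- A representation whose integrand vanishes on its domain is a relation (`[r] − [r] − [r]` is an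
integrand-additivity instance). [folklore] -/
theorem of_mem_relations_of_eqOn_zero {n : ℕ} (r : IntegralRep n) (h : EqOn r.integrand 0 r.domain) :
    KZ.of r ∈ relations := by
  have hmem : KZ.of r - KZ.of r - KZ.of r ∈ integrandAddRel :=
    ⟨n, r, r, r, rfl, rfl, fun x hx => by simp [h hx], rfl⟩
  have h' : -(KZ.of r) ∈ relations := by
    have := integrandAddRel_subset_relations hmem
    rwa [sub_self, zero_sub] at this
  simpa using relations.neg_mem h'

/-- `[r] + [−r]` is a relation (integrand additivity against the zero representation). [folklore] -/
theorem of_add_of_neg_mem_relations {n : ℕ} (r : IntegralRep n) :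
    KZ.of r + KZ.of r.neg ∈ relations := by
  set z : IntegralRep n := r.constMul 0 isAlgebraic_zero with hz_def
  have hz : KZ.of z ∈ relations := of_mem_relations_of_eqOn_zero z (fun x _ => by simp [z])
  have hmem : KZ.of z - KZ.of r - KZ.of r.neg ∈ integrandAddRel :=
    ⟨n, z, r, r.neg, rfl, rfl, fun x _ => by simp [z], rfl⟩
  have := relations.sub_mem hz (integrandAddRel_subset_relations hmem)
  convert this using 1
  abel

/-- Negating both representations does not change equivalence. [folklore] -/
theorem equivalent_neg_iff {n m : ℕ} {r : IntegralRep n} {r' : IntegralRep m} :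
    Equivalent r.neg r'.neg ↔ Equivalent r r' := by
  have h1 := of_add_of_neg_mem_relations r
  have h2 := of_add_of_neg_mem_relations r'
  unfold Equivalent
  constructor
  · intro h
    have := relations.sub_mem (relations.sub_mem h1 h2) h
    convert this using 1
    abel
  · intro h
    have := relations.sub_mem (relations.sub_mem h1 h2) h
    convert this using 1
    abel

/-- Two representations with the same domain whose integrands agree on it are equivalent
(integrand additivity against the zero representation). [folklore] -/
theorem equivalent_of_eqOn {n : ℕ} {r r' : IntegralRep n} (hd : r.domain = r'.domain)
    (hi : EqOn r.integrand r'.integrand r.domain) : Equivalent r r' := by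
  set z : IntegralRep n := r.constMul 0 isAlgebraic_zero with hz_def
  have hz : KZ.of z ∈ relations := of_mem_relations_of_eqOn_zero z (fun x _ => by simp [z])
  have hmem : KZ.of r - KZ.of r' - KZ.of z ∈ integrandAddRel :=
    ⟨n, r, r', z, hd.symm, rfl, fun x hx => by simp [z, hi hx], rfl⟩
  have := relations.add_mem (integrandAddRel_subset_relations hmem) hz
  unfold Equivalent
  convert this using 1
  abel

/-- Under the hypotheses of the crux WITHOUT positivity, value equality forces `a` and `b` to have
the same sign. [folklore] -/
theorem sign_of_value_eq {A B A' B' : ℤ} {a b : ℚ} {r r' : IntegralRep 1} (hd : r.domain = dom A B)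
    (hi : EqOn r.integrand (integrand A B a) r.domain) (hd' : r'.domain = dom A' B')
    (hi' : EqOn r'.integrand (integrand A' B' b) r'.domain) (hv : r.value = r'.value) :
    (0 < a ↔ 0 < b) ∧ (a = 0 ↔ b = 0) := by
  rcases lt_trichotomy 0 a with ha | ha | ha <;> rcases lt_trichotomy 0 b with hb | hb | hb
  · exact ⟨⟨fun _ => hb, fun _ => ha⟩, ⟨fun h => by linarith, fun h => by linarith⟩⟩
  · have h1 := value_pos ha hd hi
    subst hb
    have h2 := value_eq_zero hi'
    linarith
  · have h1 := value_pos ha hd hi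
    have h2 := value_neg_of_neg hb hd' hi'
    linarith
  · subst ha
    have h1 := value_eq_zero hi
    have h2 := value_pos hb hd' hi'
    linarith
  · subst ha; subst hb; simp
  · subst ha
    have h1 := value_eq_zero hi
    have h2 := value_neg_of_neg hb hd' hi'
    linarith
  · have h1 := value_neg_of_neg ha hd hi
    have h2 := value_pos hb hd' hi'
    linarith
  · have h1 := value_neg_of_neg ha hd hi
    subst hb
    have h2 := value_eq_zero hi'
    linarith
  · exact ⟨⟨fun h => by linarith, fun h => by linarith⟩, ⟨fun h => by linarith, fun h => by linarith⟩⟩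

/-- The crux with the hypotheses `0 < a`, `0 < b` DROPPED (all rational coefficients). -/
def RealPeriodSectorCompleteWithoutPos : Prop :=
  ∀ (A B A' B' : ℤ), 4 * A ^ 3 + 27 * B ^ 2 ≠ 0 → 4 * A' ^ 3 + 27 * B' ^ 2 ≠ 0 → ∀ (a b : ℚ),
    ∀ (r r' : IntegralRep 1),
    r.domain = {x | 0 < x 0 ^ 3 + (A : ℝ) * x 0 + (B : ℝ)} →
    EqOn r.integrand (fun x => (a : ℝ) / Real.sqrt (x 0 ^ 3 + (A : ℝ) * x 0 + (B : ℝ))) r.domain →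
    r'.domain = {x | 0 < x 0 ^ 3 + (A' : ℝ) * x 0 + (B' : ℝ)} →
    EqOn r'.integrand (fun x => (b : ℝ) / Real.sqrt (x 0 ^ 3 + (A' : ℝ) * x 0 + (B' : ℝ)))
      r'.domain →
    r.value = r'.value → Equivalent r r'

/-- **The positivity hypotheses are cosmetic**: the crux is EQUIVALENT to its version over all
rational `a`, `b`. Value equality forces `sign a = sign b` (`sign_of_value_eq`); `a = b = 0` gives
two relations; `a, b < 0` is the positive case for the negated representations
(`equivalent_neg_iff`). So `0 < a`, `0 < b` carry no information a prover could exploit. [folklore] -/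
theorem realPeriodSectorComplete_iff_withoutPos :
    RealPeriodSectorComplete ↔ RealPeriodSectorCompleteWithoutPos := by
  constructor
  · intro h A B A' B' hΔ hΔ' a b r r' hd hi hd' hi' hv
    obtain ⟨hpos, hzero⟩ := sign_of_value_eq (A := A) (B := B) (A' := A') (B' := B') hd hi hd' hi' hv
    rcases lt_trichotomy 0 a with ha | ha | ha
    · exact h A B A' B' hΔ hΔ' a b ha (hpos.1 ha) r r' hd hi hd' hi' hv
    · have hb : b = 0 := hzero.1 ha.symm
      subst hb
      have hr : KZ.of r ∈ relations := of_mem_relations_of_eqOn_zero r (fun x hx => by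
        rw [hi hx, ← ha]; simp)
      have hr' : KZ.of r' ∈ relations := of_mem_relations_of_eqOn_zero r' (fun x hx => by
        rw [hi' hx]; simp)
      exact relations.sub_mem hr hr'
    · have hb : b < 0 := by
        rcases lt_trichotomy 0 b with hb | hb | hb
        · exact absurd (hpos.2 hb) (by linarith)
        · exact absurd (hzero.2 hb.symm) (by linarith)
        · exact hb
      have hE := h A B A' B' hΔ hΔ' (-a) (-b) (by linarith) (by linarith) r.neg r'.neg hd
        (fun x hx => by
          simp only [IntegralRep.integrand_neg, Pi.neg_apply]
          rw [hi hx]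
          push_cast
          ring)
        hd'
        (fun x hx => by
          simp only [IntegralRep.integrand_neg, Pi.neg_apply]
          rw [hi' hx]
          push_cast
          ring)
        (by rw [IntegralRep.value_neg, IntegralRep.value_neg, hv])
      exact equivalent_neg_iff.1 hE
  · intro h A B A' B' hΔ hΔ' a b _ _ r r' hd hi hd' hi' hv
    exact h A B A' B' hΔ hΔ' a b r r' hd hi hd' hi' hv

/-! ## §3 Tightness: the diagonal of the crux, and the exact class structure on one curve -/

/-- On the Fermat cubic the KZ-classes are EXACTLY the coefficients:
`[σ, a/√P] ~ [σ, b/√P] ↔ a = b` (→ soundness and `ϖ₃ ≠ 0`; ← reflexivity). [folklore] -/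
theorem equivalent_fermatRep_iff (a b : ℚ) : Equivalent (fermatRep a) (fermatRep b) ↔ a = b := by
  constructor
  · intro h
    have hv := Equivalent.value_eq_holds h
    rw [value_fermatRep, value_fermatRep] at hv
    exact_mod_cast mul_right_cancel₀ fermatPeriod_pos.ne' hv
  · rintro rfl
    exact Equivalent.refl _

/-- **The diagonal `(A, B) = (A′, B′)` of the crux is a theorem** (one integrand-additivity move):
value equality forces `a = b` (scale `r` by `b/a` and compare values), and then the two
representations have the same domain and the same integrand on it. So the content of the crux is
entirely off-diagonal. [folklore] -/
theorem realPeriodSectorComplete_diag (A B : ℤ) {a b : ℚ} (ha : a ≠ 0) (r r' : IntegralRep 1)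
    (hd : r.domain = dom A B) (hi : EqOn r.integrand (integrand A B a) r.domain)
    (hd' : r'.domain = dom A B) (hi' : EqOn r'.integrand (integrand A B b) r'.domain)
    (hv : r.value = r'.value) : Equivalent r r' := by
  have halg : IsAlgebraic ℚ (((b / a : ℚ)) : ℝ) := by
    simpa using isAlgebraic_algebraMap (R := ℚ) (A := ℝ) (b / a)
  set r₂ : IntegralRep 1 := r.constMul ((b / a : ℚ) : ℝ) halg with hr₂
  have hdd : r.domain = r'.domain := hd.trans hd'.symm
  have h₂ : Equivalent r₂ r' := equivalent_of_eqOn hdd (fun x hx => by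
    have hx' : x ∈ r'.domain := hdd ▸ hx
    simp only [hr₂, IntegralRep.integrand_constMul]
    rw [hi hx, hi' hx', integrand, integrand]
    push_cast
    field_simp)
  have hv₂ : r₂.value = r'.value := Equivalent.value_eq_holds h₂
  rw [hr₂, IntegralRep.value_constMul, ← hv] at hv₂
  have hr0 : r.value ≠ 0 := by
    rcases lt_or_gt_of_ne ha with ha' | ha'
    · exact (value_neg_of_neg ha' hd hi).ne
    · exact (value_pos ha' hd hi).ne'
  have hba : ((b / a : ℚ) : ℝ) = 1 := by
    have := mul_right_cancel₀ hr0 (hv₂.trans (one_mul _).symm)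
    exact this
  have hab : b = a := by
    have : (b / a : ℚ) = 1 := by exact_mod_cast hba
    field_simp at this
    linarith
  subst hab
  exact equivalent_of_eqOn hdd (fun x hx => by rw [hi hx, hi' (hdd ▸ hx)])


/-! ## §4 Refuted natural strengthenings — and the calibration "ℚ-isomorphic models are ONE move"

Second model: `y² = x³ − 64`, the `u = 2` rescaling `(A, B) ↦ (u⁴A, u⁶B)` of the Fermat cubic;
`{x³ − 64 > 0} = (4, ∞)` and `∫_{4}^∞ dX/√(X³ − 64) = ϖ₃/2` (`X = 4x`). -/

/-- `{x³ − 64 > 0} = {x > 4}`. [folklore] -/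
theorem dom_fermat64_eq : dom 0 (-64) = (MeasurableEquiv.funUnique (Fin 1) ℝ) ⁻¹' Ioi 4 := by
  ext x
  simp only [dom, Int.cast_zero, zero_mul, add_zero, Int.cast_neg, Int.cast_ofNat, mem_setOf_eq,
    mem_preimage, mem_Ioi, funUnique_apply_eq]
  have hq : 0 < x 0 ^ 2 + 4 * x 0 + 16 := by nlinarith [sq_nonneg (x 0 + 2)]
  have hf : x 0 ^ 3 + -64 = (x 0 - 4) * (x 0 ^ 2 + 4 * x 0 + 16) := by ring
  rw [hf]
  constructor
  · intro h
    by_contra hle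
    push Not at hle
    have : (x 0 - 4) * (x 0 ^ 2 + 4 * x 0 + 16) ≤ 0 :=
      mul_nonpos_of_nonpos_of_nonneg (by linarith) hq.le
    linarith
  · intro h
    exact mul_pos (by linarith) hq

/-- The second integrand factors through `ℝ¹ ≃ ℝ`. [folklore] -/
theorem integrand_fermat64_eq (b : ℚ) :
    integrand 0 (-64) b = (fun t : ℝ => (b : ℝ) * (Real.sqrt (t ^ 3 - 64))⁻¹) ∘
      (MeasurableEquiv.funUnique (Fin 1) ℝ) := by
  funext x
  simp only [integrand, Int.cast_zero, zero_mul, add_zero, Int.cast_neg, Int.cast_ofNat,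
    Function.comp_apply, funUnique_apply_eq]
  rw [div_eq_mul_inv, ← sub_eq_add_neg]

/-- `√(64y) = 8√y`. [folklore] -/
theorem sqrt_sixtyfour_mul {y : ℝ} : Real.sqrt (64 * y) = 8 * Real.sqrt y := by
  rw [Real.sqrt_mul (by norm_num : (0 : ℝ) ≤ 64), show (64 : ℝ) = 8 ^ 2 by norm_num,
    Real.sqrt_sq (by norm_num : (0 : ℝ) ≤ 8)]

/-- `(t³ − 64)^{-1/2}` is integrable on `(4, ∞)`: it is `x ↦ (8√(x³ − 1))⁻¹` after `t = 4x`. [folklore] -/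
theorem integrableOn_inv_sqrt_cube_sub_64_Ioi :
    IntegrableOn (fun t : ℝ => (Real.sqrt (t ^ 3 - 64))⁻¹) (Ioi 4) := by
  have h1 : IntegrableOn (fun x : ℝ => (8 : ℝ)⁻¹ * (Real.sqrt (x ^ 3 - 1))⁻¹) (Ioi 1) :=
    integrableOn_inv_sqrt_cube_sub_one_Ioi.const_mul _
  have h2 : IntegrableOn (fun x : ℝ => (Real.sqrt ((4 * x) ^ 3 - 64))⁻¹) (Ioi 1) := by
    refine h1.congr_fun (fun x _ => ?_) measurableSet_Ioi
    have h64 : (4 * x) ^ 3 - 64 = 64 * (x ^ 3 - 1) := by ring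
    rw [h64, sqrt_sixtyfour_mul, mul_inv]
  have h3 := (integrableOn_Ioi_comp_mul_left_iff (f := fun t : ℝ => (Real.sqrt (t ^ 3 - 64))⁻¹)
    (c := 1) (a := 4) (by norm_num)).1 h2
  simpa using h3

/-- `b/√(x³ − 64)` is integrable on `{x³ − 64 > 0}`. [folklore] -/
theorem integrableOn_integrand_fermat64 (b : ℚ) :
    IntegrableOn (integrand 0 (-64) b) (dom 0 (-64)) := by
  rw [dom_fermat64_eq, integrand_fermat64_eq]
  exact ((volume_preserving_funUnique (Fin 1) ℝ).integrableOn_comp_preimage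
    (MeasurableEquiv.measurableEmbedding _)).2
    (integrableOn_inv_sqrt_cube_sub_64_Ioi.const_mul (b : ℝ))

/-- The real-sector representation `[{x³ − 64 > 0}, b/√(x³ − 64)]` of `y² = x³ − 64`. -/
def fermat64Rep (b : ℚ) : IntegralRep 1 where
  domain := dom 0 (-64)
  integrand := integrand 0 (-64) b
  isSemialgebraic_domain := isSemialgebraic_dom 0 (-64)
  isSemialgebraicFunOn_integrand := isSemialgebraicFunOn_integrand 0 (-64) b
  integrableOn := integrableOn_integrand_fermat64 b

/-- The hypotheses of the crux at `(A′, B′, b) = (0, −64, b)` hold for `fermat64Rep b` (by `rfl`). -/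
theorem fermat64Rep_hyps (b : ℚ) :
    (fermat64Rep b).domain = {x | 0 < x 0 ^ 3 + ((0 : ℤ) : ℝ) * x 0 + ((-64 : ℤ) : ℝ)} ∧
    EqOn (fermat64Rep b).integrand
      (fun x => (b : ℝ) / Real.sqrt (x 0 ^ 3 + ((0 : ℤ) : ℝ) * x 0 + ((-64 : ℤ) : ℝ)))
      (fermat64Rep b).domain :=
  ⟨rfl, fun _ _ => rfl⟩

/-- The scaling `x ↦ 4x` of `ℝ¹` and its derivative. -/
def Φ₄ : (Fin 1 → ℝ) → (Fin 1 → ℝ) := fun x => (4 : ℝ) • x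

/-- The (constant) derivative of `Φ₄`. -/
def Φ₄' : (Fin 1 → ℝ) →L[ℝ] (Fin 1 → ℝ) := (4 : ℝ) • ContinuousLinearMap.id ℝ (Fin 1 → ℝ)

/-- `det Φ₄′ = 4`. [folklore] -/
theorem det_Φ₄' : Φ₄'.det = 4 := by
  simp [Φ₄', ContinuousLinearMap.det, LinearMap.det_smul]

/-- `Φ₄` maps `{x > 1}` onto `{x > 4}`. [folklore] -/
theorem image_Φ₄_dom : Φ₄ '' dom 0 (-1) = dom 0 (-64) := by
  rw [dom_fermat_eq, dom_fermat64_eq]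
  ext x
  simp only [mem_image, mem_preimage, mem_Ioi, Φ₄, funUnique_apply_eq]
  constructor
  · rintro ⟨y, hy, rfl⟩
    simp only [Pi.smul_apply, smul_eq_mul]
    linarith
  · intro hx
    refine ⟨(1 / 4 : ℝ) • x, ?_, ?_⟩
    · simp only [Pi.smul_apply, smul_eq_mul]
      linarith
    · rw [smul_smul]
      norm_num

/-- **ℚ-isomorphic models are ONE change of variables**: `[{x³−1>0}, a/√(x³−1)] − [{X³−64>0},
2a/√(X³−64)]` is an instance of rule 2) with `Φ(x) = 4x` (`dX/√(X³ − 64) = dx/(2√(x³ − 1))`). This is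
the `u`-scaling case `(A′, B′) = (u⁴A, u⁶B)`, `b = u·a` of the crux, certified on the witness. [folklore] -/
theorem of_fermatRep_sub_of_fermat64Rep_mem (a : ℚ) :
    KZ.of (fermatRep a) - KZ.of (fermat64Rep (2 * a)) ∈ changeOfVariablesRel := by
  refine ⟨1, fermatRep a, fermat64Rep (2 * a), Φ₄, fun _ => Φ₄', ?_, ?_, ?_, ?_, ?_, rfl⟩
  · refine (isSemialgebraicMapOn_aeval (isSemialgebraic_dom 0 (-1))
      (fun _ => C (4 : ℚ) * X 0)).congr (fun x _ => ?_)
    funext j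
    have hj : j = 0 := Subsingleton.elim j 0
    subst hj
    simp [Φ₄]
  · intro x _
    exact (hasFDerivWithinAt_id x _).const_smul (4 : ℝ)
  · exact (smul_right_injective (Fin 1 → ℝ) (by norm_num : (4 : ℝ) ≠ 0)).injOn
  · exact image_Φ₄_dom.symm
  · intro x hx
    have hx1 : 1 < x 0 := by
      have : x ∈ (MeasurableEquiv.funUnique (Fin 1) ℝ) ⁻¹' Ioi 1 := dom_fermat_eq ▸ hx
      simpa [funUnique_apply_eq] using this
    have hP : 0 < x 0 ^ 3 + -1 := by have := cube_sub_one_pos hx1; linarith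
    have hs : 0 < Real.sqrt (x 0 ^ 3 + -1) := Real.sqrt_pos.2 hP
    show integrand 0 (-1) a x = integrand 0 (-64) (2 * a) (Φ₄ x) * |Φ₄'.det|
    rw [det_Φ₄']
    simp only [integrand, Φ₄, Pi.smul_apply, smul_eq_mul, Int.cast_zero, zero_mul, add_zero,
      Int.cast_neg, Int.cast_one, Int.cast_ofNat]
    have h64 : (4 * x 0) ^ 3 + -64 = 64 * (x 0 ^ 3 + -1) := by ring
    rw [h64, sqrt_sixtyfour_mul, abs_of_pos (by norm_num : (0 : ℝ) < 4)]
    push_cast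
    field_simp
    ring

/-- The two witnesses are KZ-equivalent (one move). [folklore] -/
theorem equivalent_fermatRep_fermat64Rep (a : ℚ) : Equivalent (fermatRep a) (fermat64Rep (2 * a)) :=
  changeOfVariablesRel_subset_relations (of_fermatRep_sub_of_fermat64Rep_mem a)

/-- `value [{X³−64>0}, 2a/√(X³−64)] = a·ϖ₃` — read off from SOUNDNESS of the move, no second
integral computed. [folklore] -/
theorem value_fermat64Rep_two_mul (a : ℚ) : (fermat64Rep (2 * a)).value = (a : ℝ) * fermatPeriod := by
  rw [← Equivalent.value_eq_holds (equivalent_fermatRep_fermat64Rep a), value_fermatRep]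

/-- `value [{X³−64>0}, b/√(X³−64)] = (b/2)·ϖ₃`. [folklore] -/
theorem value_fermat64Rep (b : ℚ) : (fermat64Rep b).value = (b : ℝ) / 2 * fermatPeriod := by
  have h := value_fermat64Rep_two_mul (b / 2)
  rw [mul_div_cancel₀ b two_ne_zero] at h
  rw [h]
  push_cast
  ring

/-- Across the two models the classes are exactly the lines `b = 2a`: the calculus sees the period
ratio and nothing else. [folklore] -/
theorem equivalent_fermatRep_fermat64Rep_iff (a b : ℚ) :
    Equivalent (fermatRep a) (fermat64Rep b) ↔ b = 2 * a := by
  constructor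
  · intro h
    have hv := Equivalent.value_eq_holds h
    rw [value_fermatRep, value_fermat64Rep] at hv
    have := mul_right_cancel₀ fermatPeriod_pos.ne' hv
    have h' : (a : ℝ) * 2 = b := by linarith
    exact_mod_cast (by linarith : (b : ℝ) = 2 * a)
  · rintro rfl
    exact equivalent_fermatRep_fermat64Rep a

/-! ### (4a) "data rigidity" is false: equivalent representations need not come from the same model -/

/-- STRENGTHENING: under the hypotheses of the crux, equivalence forces equal data. -/
def RealPeriodSectorCompleteDataRigid : Prop :=
  ∀ (A B A' B' : ℤ), 4 * A ^ 3 + 27 * B ^ 2 ≠ 0 → 4 * A' ^ 3 + 27 * B' ^ 2 ≠ 0 → ∀ (a b : ℚ),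
    0 < a → 0 < b → ∀ (r r' : IntegralRep 1),
    r.domain = {x | 0 < x 0 ^ 3 + (A : ℝ) * x 0 + (B : ℝ)} →
    EqOn r.integrand (fun x => (a : ℝ) / Real.sqrt (x 0 ^ 3 + (A : ℝ) * x 0 + (B : ℝ))) r.domain →
    r'.domain = {x | 0 < x 0 ^ 3 + (A' : ℝ) * x 0 + (B' : ℝ)} →
    EqOn r'.integrand (fun x => (b : ℝ) / Real.sqrt (x 0 ^ 3 + (A' : ℝ) * x 0 + (B' : ℝ)))
      r'.domain →
    Equivalent r r' → A = A' ∧ B = B' ∧ a = b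

/-- Refuted by the scaling witness `(0, −1, 1) ~ (0, −64, 2)`. [folklore] -/
theorem not_RealPeriodSectorCompleteDataRigid : ¬ RealPeriodSectorCompleteDataRigid := by
  intro h
  have := (h 0 (-1) 0 (-64) (by norm_num) (by norm_num) 1 2 one_pos two_pos (fermatRep 1)
    (fermat64Rep 2) (fermatRep_hyps 1).1 (fermatRep_hyps 1).2 (fermat64Rep_hyps 2).1
    (fermat64Rep_hyps 2).2 (by simpa using equivalent_fermatRep_fermat64Rep 1)).2.1
  norm_num at this

/-! ### (4b) The additivity moves (1a) + (1b) alone do NOT suffice: a change of variables (or a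
Newton–Leibniz move) is NECESSARY already for ℚ-isomorphic models -/

/-- STRENGTHENING: the crux with the conclusion sharpened to "equivalent by the additivity moves
alone". -/
def RealPeriodSectorCompleteByAdditivity : Prop :=
  ∀ (A B A' B' : ℤ), 4 * A ^ 3 + 27 * B ^ 2 ≠ 0 → 4 * A' ^ 3 + 27 * B' ^ 2 ≠ 0 → ∀ (a b : ℚ),
    0 < a → 0 < b → ∀ (r r' : IntegralRep 1),
    r.domain = {x | 0 < x 0 ^ 3 + (A : ℝ) * x 0 + (B : ℝ)} →
    EqOn r.integrand (fun x => (a : ℝ) / Real.sqrt (x 0 ^ 3 + (A : ℝ) * x 0 + (B : ℝ))) r.domain →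
    r'.domain = {x | 0 < x 0 ^ 3 + (A' : ℝ) * x 0 + (B' : ℝ)} →
    EqOn r'.integrand (fun x => (b : ℝ) / Real.sqrt (x 0 ^ 3 + (A' : ℝ) * x 0 + (B' : ℝ)))
      r'.domain →
    r.value = r'.value →
    KZ.of r - KZ.of r' ∈ AddSubgroup.closure (domainAddRel ∪ integrandAddRel)

/-- The window family `(−∞, 4]ⁿ` for the tree's invariant `KZ.restrictedEval`. -/
def W4 : (n : ℕ) → Set (Fin n → ℝ) := fun n => Set.pi univ fun _ : Fin n => Iic (4 : ℝ)

/-- The windows are measurable. [folklore] -/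
theorem measurableSet_W4 (n : ℕ) : MeasurableSet (W4 n) :=
  MeasurableSet.univ_pi fun _ => measurableSet_Iic

/-- The scaling pair is separated from the additivity sub-calculus by `restrictedEval` at the
window `x ≤ 4`: `[{x>1}, 1/√(x³−1)]` restricts to `∫₁⁴ > 0`, `[{X>4}, 2/√(X³−64)]` to `0`. [folklore] -/
theorem of_fermatRep_sub_of_fermat64Rep_not_mem_closure_add :
    KZ.of (fermatRep 1) - KZ.of (fermat64Rep 2) ∉ AddSubgroup.closure (domainAddRel ∪ integrandAddRel) := by
  intro hmem
  have hker := closure_add_le_ker_restrictedEval W4 measurableSet_W4 hmem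
  rw [AddMonoidHom.mem_ker, map_sub, restrictedEval_of, restrictedEval_of] at hker
  have h0 : ∫ x in (fermat64Rep 2).domain ∩ W4 1, (fermat64Rep 2).integrand x = 0 := by
    have hempty : (fermat64Rep 2).domain ∩ W4 1 = ∅ := by
      ext x
      simp only [mem_inter_iff, mem_empty_iff_false, iff_false, not_and]
      intro hx hW
      have hx4 : 4 < x 0 := by
        have : x ∈ (MeasurableEquiv.funUnique (Fin 1) ℝ) ⁻¹' Ioi 4 := dom_fermat64_eq ▸ hx
        simpa [funUnique_apply_eq] using this
      have hle : x 0 ≤ 4 := by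
        have := hW 0 (mem_univ _)
        simpa using this
      linarith
    rw [hempty, Measure.restrict_empty, integral_zero_measure]
  have hpos : 0 < ∫ x in (fermatRep 1).domain ∩ W4 1, (fermatRep 1).integrand x := by
    have hmeas : MeasurableSet ((fermatRep 1).domain ∩ W4 1) :=
      (IntegralRep.measurableSet_domain_holds _).inter (measurableSet_W4 1)
    rw [setIntegral_pos_iff_support_of_nonneg_ae ?_
      ((fermatRep 1).integrableOn.mono_set inter_subset_left)]
    · have hopen : IsOpen {x : Fin 1 → ℝ | 1 < x 0 ∧ x 0 < 4} :=
        (isOpen_lt continuous_const (continuous_apply 0)).inter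
          (isOpen_lt (continuous_apply 0) continuous_const)
      have hne : ({x : Fin 1 → ℝ | 1 < x 0 ∧ x 0 < 4}).Nonempty := ⟨fun _ => 2, by norm_num⟩
      refine (hopen.measure_pos volume hne).trans_le (measure_mono fun x hx => ?_)
      have hx1 : 1 < x 0 := hx.1
      have hxd : x ∈ (fermatRep 1).domain := by
        show x ∈ dom 0 (-1)
        rw [dom_fermat_eq]
        simpa [funUnique_apply_eq] using hx1
      refine ⟨?_, hxd, fun i _ => ?_⟩
      · rw [Function.mem_support]
        show integrand 0 (-1) 1 x ≠ 0
        simp only [integrand, Int.cast_zero, zero_mul, add_zero, Int.cast_neg, Int.cast_one]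
        have hP : 0 < x 0 ^ 3 + -1 := by have := cube_sub_one_pos hx1; linarith
        exact (div_pos (by norm_num) (Real.sqrt_pos.2 hP)).ne'
      · have hi : i = 0 := Subsingleton.elim i 0
        subst hi
        exact hx.2.le
    · filter_upwards [ae_restrict_mem hmeas] with x hx
      show 0 ≤ integrand 0 (-1) 1 x
      exact div_nonneg (by norm_num) (Real.sqrt_nonneg _)
  linarith

/-- **Refuted strengthening**: the additivity sub-calculus does not connect the real-sector
representations of the ℚ-isomorphic models `y² = x³ − 1`, `y² = x³ − 64` (values `ϖ₃ = ϖ₃`, by one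
change of variables). Rule 2) or 3) is NECESSARY in the sector. [folklore] -/
theorem not_RealPeriodSectorCompleteByAdditivity : ¬ RealPeriodSectorCompleteByAdditivity := by
  intro h
  exact of_fermatRep_sub_of_fermat64Rep_not_mem_closure_add
    (h 0 (-1) 0 (-64) (by norm_num) (by norm_num) 1 2 one_pos two_pos (fermatRep 1) (fermat64Rep 2)
      (fermatRep_hyps 1).1 (fermatRep_hyps 1).2 (fermat64Rep_hyps 2).1 (fermat64Rep_hyps 2).2
      (by rw [value_fermatRep, value_fermat64Rep]; norm_num))


/-! ## §5 The discriminant hypothesis: the most degenerate excluded instance is VACUOUS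

Dropping `4A³ + 27B² ≠ 0` admits singular `P`. At the cusp `A = B = 0` (`P = x³`) the hypotheses
of the crux cannot even be instantiated: `a/√(x³) = a·x^{-3/2}` is not integrable on
`{x³ > 0} = (0, ∞)`, and integrability is a field of `IntegralRep`. (The nodes `P = (x−e)²(x+2e)`,
`e ∈ ℤ`: `e > 0` is likewise vacuous — `1/|x−e|` at the double root —, `e < 0` gives the genus-0 value
`a·π/√(3|e|)`; see the module docstring, item 3.) -/

/-- `{x³ > 0} = {x > 0}` in `ℝ¹`. [folklore] -/
theorem dom_cusp_eq : dom 0 0 = (MeasurableEquiv.funUnique (Fin 1) ℝ) ⁻¹' Ioi 0 := by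
  ext x
  simp only [dom, Int.cast_zero, zero_mul, add_zero, mem_setOf_eq, mem_preimage, mem_Ioi,
    funUnique_apply_eq]
  exact (by decide : Odd 3).pow_pos_iff

/-- **The cusp is vacuous**: no integral representation has domain `{x³ > 0}` and integrand
`a/√(x³)` on it (`a ≠ 0`), because `x^{-3/2}` is not integrable on `(0, ∞)`
(`not_integrableOn_Ioi_rpow`). [folklore] -/
theorem no_rep_cusp {a : ℚ} (ha : a ≠ 0) :
    ¬ ∃ r : IntegralRep 1, r.domain = {x | 0 < x 0 ^ 3 + ((0 : ℤ) : ℝ) * x 0 + ((0 : ℤ) : ℝ)} ∧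
      EqOn r.integrand (fun x => (a : ℝ) / Real.sqrt (x 0 ^ 3 + ((0 : ℤ) : ℝ) * x 0 + ((0 : ℤ) : ℝ)))
        r.domain := by
  rintro ⟨r, hd, hi⟩
  have hd' : r.domain = (MeasurableEquiv.funUnique (Fin 1) ℝ) ⁻¹' Ioi 0 := by
    rw [hd]; exact dom_cusp_eq
  -- the integrand, transported to `ℝ`
  have h1 : IntegrableOn (fun x : Fin 1 → ℝ => (a : ℝ) / Real.sqrt (x 0 ^ 3)) r.domain := by
    refine r.integrableOn.congr_fun (fun x hx => ?_) (IntegralRep.measurableSet_domain_holds r)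
    rw [hi hx]
    simp
  have h2 : IntegrableOn ((fun t : ℝ => (a : ℝ) / Real.sqrt (t ^ 3)) ∘
      (MeasurableEquiv.funUnique (Fin 1) ℝ)) ((MeasurableEquiv.funUnique (Fin 1) ℝ) ⁻¹' Ioi 0) := by
    rw [← hd']
    exact h1
  have h3 : IntegrableOn (fun t : ℝ => (a : ℝ) / Real.sqrt (t ^ 3)) (Ioi 0) :=
    ((volume_preserving_funUnique (Fin 1) ℝ).integrableOn_comp_preimage
      (MeasurableEquiv.measurableEmbedding _)).1 h2
  have h4 : IntegrableOn (fun t : ℝ => t ^ (-(3 / 2 : ℝ))) (Ioi 0) := by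
    have h : IntegrableOn (fun t : ℝ => (a : ℝ)⁻¹ * ((a : ℝ) / Real.sqrt (t ^ 3))) (Ioi 0) :=
      h3.const_mul ((a : ℝ)⁻¹)
    refine h.congr_fun (fun t ht => ?_) measurableSet_Ioi
    have ht0 : 0 < t := ht
    have ha' : (a : ℝ) ≠ 0 := by exact_mod_cast ha
    have hsq : Real.sqrt (t ^ 3) = t ^ (3 / 2 : ℝ) := by
      rw [Real.sqrt_eq_rpow, ← Real.rpow_natCast, ← Real.rpow_mul ht0.le]
      norm_num
    show (a : ℝ)⁻¹ * ((a : ℝ) / Real.sqrt (t ^ 3)) = t ^ (-(3 / 2 : ℝ))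
    rw [hsq, Real.rpow_neg ht0.le]
    field_simp
  exact not_integrableOn_Ioi_rpow _ h4


/-! ## §6 The summit implies the crux — so its truth fails only with the summit

An algebraic dimension-1 representation `[{P>0}, a/√P]` (`a > 0`) is ONE Newton–Leibniz move away
from a RATIONAL dimension-2 representation: the area `[band, 1]`,
`band = {(x, t) | P(x) > 0, 0 ≤ t ≤ a/√P(x)}`, primitive `F(x, t) = t`. Conjecture 1 applied to the
two areas transfers back along the two moves. -/

/-- The crux integrand is Borel measurable on all of `ℝ¹` (junk values off `{P>0}` included). [folklore] -/
theorem measurable_integrand (A B : ℤ) (a : ℚ) : Measurable (integrand A B a) := by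
  unfold integrand
  fun_prop

/-- On `{P > 0}` the integrand is positive for `a > 0`. [folklore] -/
theorem integrand_pos {A B : ℤ} {a : ℚ} (ha : 0 < a) {x : Fin 1 → ℝ} (hx : x ∈ dom A B) :
    0 < integrand A B a x :=
  div_pos (by exact_mod_cast ha) (Real.sqrt_pos.2 hx)

/-- The band `{(x, t) | P(x) > 0, 0 ≤ t ≤ a/√P(x)} ⊆ ℝ²`, in the literal shape of the
Newton–Leibniz move (base `{P>0}`, lower function `0`, upper function `a/√P`). -/
def band (A B : ℤ) (a : ℚ) : Set (Fin 2 → ℝ) :=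
  {z | (Fin.init z : Fin 1 → ℝ) ∈ dom A B ∧ (fun _ : Fin 1 → ℝ => (0 : ℝ)) (Fin.init z) ≤ z (Fin.last 1) ∧
    z (Fin.last 1) ≤ integrand A B a (Fin.init z)}

/-- The band is `ℚ`-semialgebraic (closed hypograph of a semialgebraic function, Tarski–Seidenberg,
cut by `t ≥ 0`). [folklore] -/
theorem isSemialgebraic_band (A B : ℤ) (a : ℚ) : IsSemialgebraic ℚ (band A B a) := by
  have h1 := (isSemialgebraicFunOn_integrand A B a).isSemialgebraic_setOf_le
    Literature.ModelTheory.ExponentialFields.tarski_seidenberg_real_holds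
  have h2 : IsSemialgebraic ℚ {v : Fin 2 → ℝ | 0 ≤ v (Fin.last 1)} := by
    have := Literature.ModelTheory.ExponentialFields.isSemialgebraic_setOf_eval_nonneg (k := ℚ)
      (R := ℝ) (X (Fin.last 1) : MvPolynomial (Fin 2) ℚ)
    simpa using this
  convert h1.inter h2 using 1
  ext z
  simp only [band, mem_setOf_eq, mem_inter_iff]
  tauto

/-- The band has finite volume: `≤ ∫_{P>0} 3a/√P < ∞` (it lies in the region between `−a/√P` and
`2a/√P`, whose volume is a Lebesgue integral by `volume_regionBetween_eq_lintegral'`). [folklore] -/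
theorem volume_band_lt_top {A B : ℤ} {a : ℚ} (ha : 0 < a)
    (hint : IntegrableOn (integrand A B a) (dom A B)) : volume (band A B a) < ⊤ := by
  have hσ : MeasurableSet (dom A B) :=
    Literature.ModelTheory.ExponentialFields.IsSemialgebraic.measurableSet_holds (isSemialgebraic_dom A B)
  have hg : Measurable (integrand A B a) := measurable_integrand A B a
  set e : (Fin 2 → ℝ) ≃ᵐ ℝ × (Fin 1 → ℝ) :=
    MeasurableEquiv.piFinSuccAbove (fun _ => ℝ) (Fin.last 1) with he_def
  have he : MeasurePreserving e volume volume :=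
    volume_preserving_piFinSuccAbove (fun _ => ℝ) (Fin.last 1)
  have he_symm : ∀ p : ℝ × (Fin 1 → ℝ), e.symm p = Fin.snoc p.2 p.1 := fun p => by
    rw [he_def]
    exact Fin.insertNth_last' p.1 p.2
  have h1 : volume (band A B a) = volume (e.symm ⁻¹' band A B a) :=
    ((he.symm e).measure_preimage_equiv (band A B a)).symm
  set R : Set ((Fin 1 → ℝ) × ℝ) :=
    regionBetween (-integrand A B a) (fun x => 2 * integrand A B a x) (dom A B) with hR_def
  have hRm : MeasurableSet R := measurableSet_regionBetween hg.neg (hg.const_mul 2) hσ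
  have hsub : e.symm ⁻¹' band A B a ⊆ Prod.swap ⁻¹' R := by
    intro p hp
    have hp' : Fin.snoc p.2 p.1 ∈ band A B a := by simpa [he_symm] using hp
    obtain ⟨hσp, h0, hle⟩ := hp'
    rw [Fin.init_snoc] at hσp hle
    rw [Fin.snoc_last] at h0 hle
    have hgpos : 0 < integrand A B a p.2 := integrand_pos ha hσp
    refine ⟨hσp, ?_, ?_⟩
    · show -integrand A B a p.2 < p.1
      have : (0 : ℝ) ≤ p.1 := h0
      linarith
    · show p.1 < 2 * integrand A B a p.2
      linarith
  have hvol : volume (Prod.swap ⁻¹' R) = (volume : Measure (Fin 1 → ℝ)).prod volume R := by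
    rw [Measure.volume_eq_prod]
    exact (Measure.measurePreserving_swap).measure_preimage hRm.nullMeasurableSet
  rw [h1]
  refine (measure_mono hsub).trans_lt ?_
  rw [hvol, hR_def, volume_regionBetween_eq_lintegral' hg.neg (hg.const_mul 2) hσ]
  have h3 : IntegrableOn (fun x => 3 * integrand A B a x) (dom A B) := hint.const_mul 3
  calc ∫⁻ y in dom A B, ENNReal.ofReal (((fun x => 2 * integrand A B a x) - (-integrand A B a)) y)
      = ∫⁻ y in dom A B, ENNReal.ofReal (3 * integrand A B a y) := by
        congr 1
        funext y
        simp only [Pi.sub_apply, Pi.neg_apply]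
        ring_nf
    _ ≤ ∫⁻ y in dom A B, ‖3 * integrand A B a y‖ₑ := lintegral_ofReal_le_lintegral_enorm _
    _ < ⊤ := h3.2

/-- Integrability of `a/√P` on `{P>0}` is part of any representation satisfying the hypotheses. [folklore] -/
theorem integrableOn_of_rep {A B : ℤ} {a : ℚ} (r : IntegralRep 1) (hd : r.domain = dom A B)
    (hi : EqOn r.integrand (integrand A B a) r.domain) : IntegrableOn (integrand A B a) (dom A B) := by
  rw [← hd]
  exact r.integrableOn.congr_fun hi (IntegralRep.measurableSet_domain_holds r)

/-- The RATIONAL dimension-2 representation `[band, 1]` (the area under the graph of `a/√P`). -/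
def bandRep (A B : ℤ) (a : ℚ) (ha : 0 < a) (hint : IntegrableOn (integrand A B a) (dom A B)) :
    IntegralRep 2 where
  domain := band A B a
  integrand := fun _ => 1
  isSemialgebraic_domain := isSemialgebraic_band A B a
  isSemialgebraicFunOn_integrand :=
    isSemialgebraicFunOn_const_of_isAlgebraic (isSemialgebraic_band A B a) isAlgebraic_one
  integrableOn := (integrableOn_const_iff (by simp)).2 (Or.inr (volume_band_lt_top ha hint))

/-- `[band, 1]` has KZ's literal rational shape (`1 = 1/1`). [folklore] -/
theorem isRational_bandRep (A B : ℤ) (a : ℚ) (ha : 0 < a)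
    (hint : IntegrableOn (integrand A B a) (dom A B)) : (bandRep A B a ha hint).IsRational :=
  ⟨1, 1, fun x _ => by simp, fun x _ => by simp [bandRep]⟩

/-- **The lift is one Newton–Leibniz move**: `[band, 1] − [{P>0}, a/√P] ∈ newtonLeibnizRel`
(primitive `F(x,t) = t`, lower function `0`, upper function `a/√P`). [folklore] -/
theorem of_bandRep_sub_of_mem_newtonLeibnizRel {A B : ℤ} {a : ℚ} (ha : 0 < a) (r : IntegralRep 1)
    (hd : r.domain = dom A B) (hi : EqOn r.integrand (integrand A B a) r.domain) :
    KZ.of (bandRep A B a ha (integrableOn_of_rep r hd hi)) - KZ.of r ∈ newtonLeibnizRel := by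
  refine ⟨1, bandRep A B a ha (integrableOn_of_rep r hd hi), r, fun _ => 0, integrand A B a,
    fun z => z (Fin.last 1), ?_, ?_, ?_, ?_, ?_, ?_, ?_, ?_, rfl⟩
  · have := isSemialgebraicFunOn_aeval (isSemialgebraic_band A B a)
      (X (Fin.last 1) : MvPolynomial (Fin 2) ℚ)
    refine this.congr (fun z _ => ?_)
    simp
  · rw [hd]
    exact isSemialgebraicFunOn_const_of_isAlgebraic (isSemialgebraic_dom A B) isAlgebraic_zero
  · rw [hd]
    exact isSemialgebraicFunOn_integrand A B a
  · intro x hx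
    rw [hd] at hx
    exact (integrand_pos ha hx).le
  · show band A B a = _
    rw [hd]
    rfl
  · intro x _
    have : (fun t : ℝ => (Fin.snoc x t : Fin 2 → ℝ) (Fin.last 1)) = id :=
      funext fun t => Fin.snoc_last _ _
    rw [this]
    exact continuousOn_id
  · intro x _ t _
    show HasDerivAt (fun s : ℝ => (Fin.snoc x s : Fin 2 → ℝ) (Fin.last 1)) 1 t
    have : (fun s : ℝ => (Fin.snoc x s : Fin 2 → ℝ) (Fin.last 1)) = id :=
      funext fun s => Fin.snoc_last _ _
    rw [this]
    exact hasDerivAt_id t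
  · intro x hx
    beta_reduce
    rw [Fin.snoc_last, Fin.snoc_last, sub_zero]
    exact hi hx

/-- **The summit implies the crux**: `RealPeriodSectorComplete` is a consequence of Conjecture 1
(`KontsevichZagierPeriods`), via the two Newton–Leibniz lifts and soundness (the lifts preserve
values, so the two rational areas have equal values). Hence the crux can fail only together with
the summit: no refutation of it short of a disproof of the Kontsevich–Zagier conjecture as
formalised. [folklore] -/
theorem realPeriodSectorComplete_of_kontsevichZagierPeriods (h : KontsevichZagierPeriods) :
    RealPeriodSectorComplete := by
  intro A B A' B' _ _ a b ha hb r r' hd hi hd' hi' hv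
  have hE : Equivalent (bandRep A B a ha (integrableOn_of_rep r hd hi)) r :=
    newtonLeibnizRel_subset_relations (of_bandRep_sub_of_mem_newtonLeibnizRel ha r hd hi)
  have hE' : Equivalent (bandRep A' B' b hb (integrableOn_of_rep r' hd' hi')) r' :=
    newtonLeibnizRel_subset_relations (of_bandRep_sub_of_mem_newtonLeibnizRel hb r' hd' hi')
  have hvR : (bandRep A B a ha (integrableOn_of_rep r hd hi)).value =
      (bandRep A' B' b hb (integrableOn_of_rep r' hd' hi')).value := by
    rw [Equivalent.value_eq_holds hE, Equivalent.value_eq_holds hE', hv]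
  have hRR' := (KontsevichZagierPeriods_iff.1 h) _ _ (isRational_bandRep A B a ha _)
    (isRational_bandRep A' B' b hb _) hvR
  exact (hE.symm.trans hRR').trans hE'


/-! ## §7 Computations: explicit off-diagonal inhabitants (kit jobs j013811, j013822; PARI/GP 2.15, AGM periods)

`Ω⁺(A,B) := ∫_{x³+Ax+B>0} dx/√(x³+Ax+B)`. Each line `(A,B) ~ (A′,B′)  ρ` below means
`Ω⁺(A,B)/Ω⁺(A′,B′) = ρ ∈ ℚ` (to `10⁻⁴⁰`; in fact to `10⁻⁷⁵`) with the two curves ℚ-isogenous and NOT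
ℚ-isomorphic — so `a·Ω⁺(A,B) = b·Ω⁺(A′,B′)` exactly when `b/a = ρ`, and every such
`(A, B, a; A′, B′, b)` is an instance of the crux with equal values and genuinely different curves.
Test data for provers of crux 3 / crux 4 (the chain must realise the isogeny).

BOX `|A|,|B| ≤ 30` (all 39 isogenous pairs; `N` = conductor):
```
(-1,0)~(4,0) 2 N32      (-2,0)~(8,0) 2        (-3,0)~(12,0) 2      (-4,0)~(16,0) 2     (-4,0)~(1,0) 1
(-5,0)~(20,0) 2         (-6,0)~(24,0) 2       (-7,0)~(28,0) 2      (-8,0)~(2,0) 1      (-12,0)~(3,0) 1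
(-16,0)~(4,0) 1         (-20,0)~(5,0) 1       (-24,0)~(6,0) 1      (-28,0)~(7,0) 1     (-16,0)~(-11,-14) 1
(-16,0)~(-11,14) 1/2    (-11,-14)~(-11,14) 1/2  (-11,-14)~(-1,0) 1/2  (-11,-14)~(4,0) 1  (-11,14)~(-1,0) 1
(-11,14)~(4,0) 2  [j = 1728, 287496: class 32a]
(0,-27)~(0,1) 1/3 N36   (0,-1)~(0,27) 1 N144  (-15,-22)~(0,-1) 1   (-15,-22)~(0,27) 1  (-15,22)~(0,-27) 3
(-15,22)~(0,1) 1  [j = 0, 54000: classes 36a, 144]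
(-19,-30)~(1,-2) 1 N112   (-19,30)~(1,2) 1 N56   (-20,-16)~(-10,12) 1/2 N896   (-20,16)~(-10,-12) 1 N896
(-7,-6)~(-2,1) 1/2 N40    (-7,6)~(-2,-1) 1 N80   (-6,-5)~(9,-26) 2 N1008      (-6,5)~(9,26) 2 N504
(-5,-4)~(5,-18) 2 N544    (-5,4)~(5,18) 2 N544   (-4,-3)~(1,-10) 2 N52        (-4,3)~(1,10) 2 N208   [non-CM]
```
ISOGENY CLASSES (j013822; integral short models of every curve in the class, `ρᵢ = Ω⁺(E₁)/Ω⁺(Eᵢ)`,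
`[deg E₁ → Eᵢ]`):
```
11a: E1 (-13392,-1080432); E2 (-10135152,-12419196912) ρ=5 [5]; E3 (-432,8208) ρ=1/5 [5]
14a: E1 (5805,-285714); (-675,13662) 1/3 [3]; (-220995,-40102722) 3 [3]; (-46035,-3116178) 1 [2];
     (-13635,612414) 1/3 [6]; (-3538755,-2562263874) 3 [6]
15a: E1 (-12987,-263466); (-6507,199206) 1/2 [2]; (-103707,12854646) 1/2 [4]; (-27,8694) 1/2 [4];
     (45333,-1978074) 2 [2]; (-174987,-28159866) 2 [2]; (-142587,-38910186) 4 [4]; (-2799387,-1802779146) 4 [4]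
17a: E1 (-11,-890); (-91,-330) 1/2 [2]; (-11,6) 1/4 [4]; (-1451,-21274) 1 [4]
19a: E1 (-12096,-544752); (864,-432) 1/3 [3]; (-997056,-383201712) 3 [3]
20a: E1 (297,1998); (-2943,-93258) 3 [3]; (-108,297) 1/2 [2]; (-3348,-74547) 3/2 [6]
21a: E1 (-5211,-31050); (-50571,4350726) 1 [2]; (1269,-3834) 1 [2]; (-63531,-6154650) 2 [2];
     (-44091,-9992106) 4 [4]; (-1016091,-394227594) 4 [4]
26b: E1 (-43,166); (-3403,-83834) 7 [7]
27a (CM): E1 (0,-432); (0,16) 1/3 [3]; (-480,4048) 1/3 [9]; (-4320,-109296) 3 [3]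
30a: E1 (1917,99198); (-24003,1296702) 1 [2]; (-373923,88006878) 1 [4]; (-88803,-8773218) 2 [4];
     (-17523,-2921778) 3 [3]; (-432243,-109173042) 3 [6]; (-587763,-23605938) 3 [12]; (-6912243,-6994821042) 6 [12]
32a (CM): E1 (4,0); (-1,0) 1/2 [2]; (-11,14) 1/2 [4]; (-11,-14) 1 [4]
36a (CM): E1 (0,1); (0,-27) 3 [3]; (-15,22) 1 [2]; (-135,-594) 3 [6]
37b: E1 (-30240,-1959984); (-4320,108432) 1/3 [3]; (-2427840,-1456056432) 3 [3]
49a (CM): E1 (-35,-98); (-595,-5586) 1 [2]; (-1715,33614) 1 [7]; (-29155,1915998) 1 [14]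
37-isogeny (j=-9317; N=2946861225 for this twist): (-308718795,-2273199393850) ~
     (-8009035567995,8724056049444300950) ρ=1 [37]
CM 43: (-4214000,-3329586750) ~ (-7791686000,264725453732250) ρ=1 [43]
CM 67: (-151173207108000,-715418812525615506000) ~ (-678616526707812000,215171508311641696431078000) ρ=1 [67]
CM 163: (-30056174633699993112642000,-63423276123735942491056611552320342250) ~
     (-798562503842775117009785298000,274670162803041061735315947310376665238160750) ρ=1 [163]
```
Observations for provers: (i) `ρ` is always `d/m`-shaped with `d | deg` up to the factor 2 from
component counts (`#realroots` changes across many 2-isogenies); (ii) equal real-sector periods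
(`ρ = 1`) occur for isogenies of every large prime degree (37, 43, 67, 163) — these are the
instances where the chain of crux 3 is longest (`≈ 3·deg` monotone pieces). -/

end Summit.KontsevichZagierPeriods.KontsevichZagierPeriods.Cruxes.RealPeriodSectorComplete.Disproof
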